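import Literature.MathematicalPhysics.QuantumLattice.HubbardNNNHoppingEnergyDensityConcave
import HarnessLib

/-!
# `t'`-chord lower bounds and `t'`-extrapolation upper bounds for the Hubbard thermodynamic-limit energy density

Corollaries of concavity in the next-nearest-neighbour hopping `t'`
(`concaveOn_energyDensityTT'_tPrime`: for `0 ≤ U` and `0 ≤ n < 2` the map `t' ↦ e(t,t',U,n)` is
concave on `ℝ`, the pointwise limit of minima of affine functions of the coupling): certified LOWER
bounds at two values `s₁ < s₂` of `t'` give the chord lower bound at every `t'` between them, and a
certified lower bound at one value together with a certified UPPER bound at another give extrapolated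
upper bounds OUTSIDE the segment (the slopes of a concave function decrease).  These are the
line-by-line `t'`-twins of the `U`-direction `energyDensityTT'_chord_le` /
`energyDensityTT'_le_extrapolate` of `HubbardNNNHoppingEnergyDensityConcave.lean` (both one-sided
versions are needed in `t'`, which is not restricted to a half-line), and the by-name forms of the
"t′-chord" / "t′-secant" rules used by the certified-bound tables; the last theorem is the
`t' = -1/5` instance shape.  [cite: Ruelle1969, §3.3]

Drafted and farm-checked by the sr-mbsolver M3 seat m3-4 (g15, `tprime-concavity/TPrimeChord.lean`);
filed as a separate leaf module so that no existing module is invalidated.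
-/

namespace Literature.MathematicalPhysics.QuantumLattice

namespace ThermodynamicLimit

open Set

/-- **Interpolated lower bounds in `t'`.** For `s₁ < s < s₂`, `0 ≤ U`, `0 ≤ n < 2` and certified
lower bounds `L₁ ≤ e(t,s₁,U,n)`, `L₂ ≤ e(t,s₂,U,n)`:
`((s₂ - s) L₁ + (s - s₁) L₂)/(s₂ - s₁) ≤ e(t,s,U,n)` (concavity in `t'`: `e` lies above its
chords). [cite: Ruelle1969, §3.3] -/
theorem energyDensityTT'_tPrime_chord_le (t : ℝ) {U : ℝ} (hU : 0 ≤ U) {n : ℝ} (hn0 : 0 ≤ n)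
    (hn2 : n < 2) {s₁ s s₂ L₁ L₂ : ℝ} (h₁ : s₁ < s) (h₂ : s < s₂)
    (hL₁ : L₁ ≤ energyDensityTT' t s₁ U n) (hL₂ : L₂ ≤ energyDensityTT' t s₂ U n) :
    ((s₂ - s) * L₁ + (s - s₁) * L₂) / (s₂ - s₁) ≤ energyDensityTT' t s U n := by
  have hd : 0 < s₂ - s₁ := by linarith
  set p : ℝ := (s₂ - s) / (s₂ - s₁) with hp'
  set q : ℝ := (s - s₁) / (s₂ - s₁) with hq'
  have hp : 0 ≤ p := div_nonneg (by linarith) hd.le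
  have hq : 0 ≤ q := div_nonneg (by linarith) hd.le
  have hpq : p + q = 1 := by
    rw [hp', hq', ← add_div, div_eq_one_iff_eq hd.ne']
    ring
  have hc := (concaveOn_energyDensityTT'_tPrime t hU hn0 hn2).2 (mem_univ s₁) (mem_univ s₂)
    hp hq hpq
  simp only [smul_eq_mul] at hc
  have hs : p * s₁ + q * s₂ = s := by
    rw [hp', hq']
    field_simp
    ring
  rw [hs] at hc
  have e1 : ((s₂ - s) * L₁ + (s - s₁) * L₂) / (s₂ - s₁) = p * L₁ + q * L₂ := by
    rw [hp', hq']
    field_simp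
  rw [e1]
  have h1 := mul_le_mul_of_nonneg_left hL₁ hp
  have h2 := mul_le_mul_of_nonneg_left hL₂ hq
  linarith

/-- **Extrapolated upper bounds in `t'`, to the right.** For `s₁ < s₂ < s₃`, a certified LOWER
bound `L₁ ≤ e(t,s₁,U,n)` and a certified UPPER bound `e(t,s₂,U,n) ≤ R₂` give, beyond `s₂`,
`e(t,s₃,U,n) ≤ R₂ + (R₂ - L₁)(s₃ - s₂)/(s₂ - s₁)` (the chord through `s₁, s₂` extended to `s₃`
lies above the concave `e`). [cite: Ruelle1969, §3.3] -/
theorem energyDensityTT'_tPrime_le_extrapolate_right (t : ℝ) {U : ℝ} (hU : 0 ≤ U) {n : ℝ}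
    (hn0 : 0 ≤ n) (hn2 : n < 2) {s₁ s₂ s₃ L₁ R₂ : ℝ} (h₁ : s₁ < s₂) (h₂ : s₂ < s₃)
    (hL₁ : L₁ ≤ energyDensityTT' t s₁ U n) (hR₂ : energyDensityTT' t s₂ U n ≤ R₂) :
    energyDensityTT' t s₃ U n ≤ R₂ + (R₂ - L₁) * (s₃ - s₂) / (s₂ - s₁) := by
  -- `s₂` is an interior point of `[s₁, s₃]`: `e(s₂) ≥ chord(s₁, s₃)`
  have h := energyDensityTT'_tPrime_chord_le t hU hn0 hn2 (s₁ := s₁) (s := s₂) (s₂ := s₃)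
    h₁ h₂ hL₁ le_rfl
  have hd : 0 < s₃ - s₁ := by linarith
  have hd' : 0 < s₂ - s₁ := by linarith
  rw [div_le_iff₀ hd] at h
  have hR := mul_le_mul_of_nonneg_right hR₂ hd.le
  have key : energyDensityTT' t s₃ U n * (s₂ - s₁) ≤ R₂ * (s₂ - s₁) + (R₂ - L₁) * (s₃ - s₂) := by
    nlinarith [h, hR]
  have e : R₂ + (R₂ - L₁) * (s₃ - s₂) / (s₂ - s₁) =
      (R₂ * (s₂ - s₁) + (R₂ - L₁) * (s₃ - s₂)) / (s₂ - s₁) := by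
    field_simp
  rw [e, le_div_iff₀ hd']
  exact key

/-- **Extrapolated upper bounds in `t'`, to the left.** For `s₀ < s₁ < s₂`, a certified UPPER
bound `e(t,s₁,U,n) ≤ R₁` and a certified LOWER bound `L₂ ≤ e(t,s₂,U,n)` give, below `s₁`,
`e(t,s₀,U,n) ≤ R₁ + (R₁ - L₂)(s₁ - s₀)/(s₂ - s₁)` (the chord through `s₁, s₂` extended down to
`s₀` lies above the concave `e`; this is the hole-doped `t' < t'₁` side). [cite: Ruelle1969, §3.3] -/
theorem energyDensityTT'_tPrime_le_extrapolate_left (t : ℝ) {U : ℝ} (hU : 0 ≤ U) {n : ℝ}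
    (hn0 : 0 ≤ n) (hn2 : n < 2) {s₀ s₁ s₂ R₁ L₂ : ℝ} (h₀ : s₀ < s₁) (h₁ : s₁ < s₂)
    (hR₁ : energyDensityTT' t s₁ U n ≤ R₁) (hL₂ : L₂ ≤ energyDensityTT' t s₂ U n) :
    energyDensityTT' t s₀ U n ≤ R₁ + (R₁ - L₂) * (s₁ - s₀) / (s₂ - s₁) := by
  -- `s₁` is an interior point of `[s₀, s₂]`: `e(s₁) ≥ chord(s₀, s₂)`
  have h := energyDensityTT'_tPrime_chord_le t hU hn0 hn2 (s₁ := s₀) (s := s₁) (s₂ := s₂)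
    h₀ h₁ le_rfl hL₂
  have hd : 0 < s₂ - s₀ := by linarith
  have hd' : 0 < s₂ - s₁ := by linarith
  rw [div_le_iff₀ hd] at h
  have hR := mul_le_mul_of_nonneg_right hR₁ hd.le
  have key : energyDensityTT' t s₀ U n * (s₂ - s₁) ≤ R₁ * (s₂ - s₁) + (R₁ - L₂) * (s₁ - s₀) := by
    nlinarith [h, hR]
  have e : R₁ + (R₁ - L₂) * (s₁ - s₀) / (s₂ - s₁) =
      (R₁ * (s₂ - s₁) + (R₁ - L₂) * (s₁ - s₀)) / (s₂ - s₁) := by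
    field_simp
  rw [e, le_div_iff₀ hd']
  exact key

/-- **The R-M3-95 (a) instance shape**: a certified lower bound at `t' = -1/5` from certified
lowers `L₀ ≤ e(t,0,U,n)` and `L₁ ≤ e(t,-1/4,U,n)`: `L₀/5 + 4 L₁/5 ≤ e(t,-1/5,U,n)`
(the `t' = -1/5` chord of the `t' = 0` and `t' = -1/4` columns). [cite: Ruelle1969, §3.3] -/
theorem energyDensityTT'_tPrime_neg_one_fifth_le (t : ℝ) {U : ℝ} (hU : 0 ≤ U) {n : ℝ}
    (hn0 : 0 ≤ n) (hn2 : n < 2) {L₀ L₁ : ℝ} (hL₀ : L₀ ≤ energyDensityTT' t 0 U n)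
    (hL₁ : L₁ ≤ energyDensityTT' t (-1/4) U n) :
    L₀ / 5 + 4 * L₁ / 5 ≤ energyDensityTT' t (-1/5) U n := by
  have h := energyDensityTT'_tPrime_chord_le t hU hn0 hn2 (s₁ := -1/4) (s := -1/5) (s₂ := 0)
    (by norm_num) (by norm_num) hL₁ hL₀
  have e : ((0 - (-1/5 : ℝ)) * L₁ + (-1/5 - (-1/4)) * L₀) / (0 - (-1/4)) = L₀ / 5 + 4 * L₁ / 5 := by
    ring
  rw [e] at h
  exact h

end ThermodynamicLimit

end Literature.MathematicalPhysics.QuantumLattice
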